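import Literature.Topology.Euclidean.BrouwerFixedPoint
import Mathlib.Topology.Homotopy.Lifting
import Mathlib.Topology.Covering.Basic
import Mathlib.Analysis.Convex.PathConnected
import HarnessLib

/-!
# A covering map of a vector space whose "balls" are saturated is injective (Brouwer argument)

Support file (everything proved, no definitions, no named facts) for the discharge of
`Literature.Geometry.Riemannian.ggsu_boundary_sphere_of_nonTrapping_of_nonpos`
(`SimpleAHBoundarySphere.lean`; Graham–Guillarmou–Stefanov–Uhlmann, Ann. Inst. Fourier 69 (2019),
p. 10: "if `(M, g)` is non-trapping, then `M` is necessarily simply connected"). The topological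
mechanism used in the tree's proof of that remark: let `F : E → N` be a covering map from a real
finite-dimensional inner product space and `K ∋ 0` a star-shaped subset homeomorphic to the closed
unit ball which is `F`-saturated (`F⁻¹(F(K)) ⊆ K`; downstream `F = exp_p` and `K = exp_p⁻¹{ρ ≥ ε}`).
Then the fibre of `F` over `F 0` is `{0}` (`preimage_apply_zero_eq_of_star`): lifting the
homotopy `(s, w) ↦ F(s w)` from a point `w₀` of that fibre gives a self-map of `K`, which has a
fixed point by **Brouwer's fixed point theorem**
(`Literature.Topology.Euclidean.Brouwer.exists_fixedPoint_closedBall`); by uniqueness of lifts the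
lifted end map is the identity, so the lift of the constant path at `0` ends at `0 = w₀`.
Consequently `F` is injective when `N` is path connected (`injective_of_star`, monodromy).

## References

* C. R. Graham, C. Guillarmou, P. Stefanov, G. Uhlmann, Ann. Inst. Fourier 69 (2019), p. 10.
  [GrahamEtAl2020]
* A. Hatcher, *Algebraic Topology* (2002), Prop. 1.30 (homotopy lifting), Prop. 1.34.
-/

noncomputable section

open Set Function Metric Topology unitInterval

namespace Literature.Geometry.Riemannian

namespace SimpleAH

variable {E : Type*} [NormedAddCommGroup E] [InnerProductSpace ℝ E] [FiniteDimensional ℝ E]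
  {N : Type*} [TopologicalSpace N] {F : E → N}

/-- **The fibre over the centre of a saturated star-shaped ball is trivial.** Let `F : E → N` be a
covering map, `K ⊆ E` star-shaped about `0 ∈ K`, homeomorphic to the closed unit ball, and
saturated (`F w ∈ F(K) → w ∈ K`). Then `F⁻¹{F 0} = {0}`. Proof: for `w₀` in the fibre, lift the
homotopy `H(s, w) = F(s w)` on `K` starting from the constant lift `w₀`; the end map `T` is a
continuous self-map of `K` (saturation), so has a fixed point (Brouwer); `T` and the inclusion are
two lifts of `F|_K` agreeing at that point, hence equal (`K` is connected), so `T 0 = 0`; but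
`s ↦ H̃(s, 0)` lifts a constant path, so `T 0 = w₀`. [cite: GrahamEtAl2020, p. 10] -/
theorem preimage_apply_zero_eq_of_star (hF : IsCoveringMap F) {K : Set E} (h0 : (0 : E) ∈ K)
    (hstar : StarConvex ℝ (0 : E) K) (hsat : ∀ w, F w ∈ F '' K → w ∈ K)
    (e : K ≃ₜ closedBall (0 : E) 1) : F ⁻¹' {F 0} = {0} := by
  ext w₀
  simp only [mem_preimage, mem_singleton_iff]
  refine ⟨fun hw₀ ↦ ?_, fun h ↦ by rw [h]⟩
  have hw₀K : w₀ ∈ K := hsat w₀ ⟨0, h0, hw₀.symm⟩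
  haveI : PreconnectedSpace K :=
    Subtype.preconnectedSpace (hstar.isPathConnected h0).isConnected.isPreconnected
  -- the homotopy `H(s, w) = F(s • w)` on `K` and its lift from the constant map `w₀`
  set H : C(I × K, N) := ⟨fun q ↦ F ((q.1 : ℝ) • (q.2 : E)),
    hF.continuous.comp ((continuous_subtype_val.comp continuous_fst).smul
      (continuous_subtype_val.comp continuous_snd))⟩ with hH
  set f₀ : C(K, E) := ContinuousMap.const K w₀ with hf₀
  have H_0 : ∀ a : K, H (0, a) = F (f₀ a) := by
    intro a
    show F (((0 : I) : ℝ) • (a : E)) = F w₀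
    rw [show ((0 : I) : ℝ) = 0 from rfl, zero_smul, hw₀]
  set Hl := hF.liftHomotopy H f₀ H_0 with hHl
  have hlifts : ∀ q : I × K, F (Hl q) = H q := fun q ↦ congr_fun (hF.liftHomotopy_lifts H f₀ H_0) q
  have hzero : ∀ a : K, Hl (0, a) = w₀ := fun a ↦ hF.liftHomotopy_zero H f₀ H_0 a
  -- the end map is a continuous self-map of `K`
  have hmemK : ∀ w : K, Hl (1, w) ∈ K := by
    intro w
    apply hsat
    refine ⟨w, w.2, ?_⟩
    rw [hlifts (1, w)]
    show F (w : E) = F (((1 : I) : ℝ) • (w : E))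
    rw [show ((1 : I) : ℝ) = 1 from rfl, one_smul]
  set T : K → K := fun w ↦ ⟨Hl (1, w), hmemK w⟩ with hT
  have hTc : Continuous T := (Hl.continuous.comp (Continuous.prodMk_right (1 : I))).subtype_mk _
  -- Brouwer: a fixed point of `e ∘ T ∘ e⁻¹` on the closed unit ball
  classical
  set gmap : E → E := fun x ↦ if hx : x ∈ closedBall (0 : E) 1 then (e (T (e.symm ⟨x, hx⟩)) : E)
    else x with hg
  have hgB : MapsTo gmap (closedBall (0 : E) 1) (closedBall (0 : E) 1) := by
    intro x hx
    simp only [hg, dif_pos hx]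
    exact (e (T (e.symm ⟨x, hx⟩))).2
  have hgc : ContinuousOn gmap (closedBall (0 : E) 1) := by
    rw [continuousOn_iff_continuous_restrict]
    have : (closedBall (0 : E) 1).restrict gmap =
        fun x ↦ (e (T (e.symm x)) : E) := by
      funext x
      simp only [restrict_apply, hg, dif_pos x.2]
    rw [this]
    exact continuous_subtype_val.comp (e.continuous.comp (hTc.comp e.symm.continuous))
  obtain ⟨x, hx, hfix⟩ := Literature.Topology.Euclidean.Brouwer.exists_fixedPoint_closedBall hgc hgB
  -- the fixed point of `T`
  set wstar : K := e.symm ⟨x, hx⟩ with hwstar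
  have hTfix : T wstar = wstar := by
    have h1 : (e (T wstar) : E) = x := by
      have := hfix
      simp only [hg, dif_pos hx] at this
      exact this
    have h2 : e (T wstar) = ⟨x, hx⟩ := Subtype.ext h1
    have h3 := congrArg e.symm h2
    rwa [e.symm_apply_apply] at h3
  -- the end map and the inclusion are lifts of `F|_K` agreeing at `wstar`, hence equal
  have hlift_eq : (fun w : K ↦ Hl (1, w)) = (Subtype.val : K → E) := by
    refine hF.eq_of_comp_eq (Hl.continuous.comp (Continuous.prodMk_right (1 : I)))
      continuous_subtype_val ?_ wstar ?_
    · funext w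
      show F (Hl (1, w)) = F (w : E)
      rw [hlifts (1, w)]
      show F (((1 : I) : ℝ) • (w : E)) = F (w : E)
      rw [show ((1 : I) : ℝ) = 1 from rfl, one_smul]
    · show Hl (1, wstar) = (wstar : E)
      exact congrArg Subtype.val hTfix
  have hend0 : Hl (1, ⟨0, h0⟩) = 0 := congr_fun hlift_eq ⟨0, h0⟩
  -- the lift of the constant path at `0` is constant
  have hconst : (fun s : I ↦ Hl (s, ⟨0, h0⟩)) = fun _ : I ↦ w₀ := by
    refine hF.eq_of_comp_eq (Hl.continuous.comp (Continuous.prodMk_left (⟨0, h0⟩ : K)))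
      continuous_const ?_ 0 (hzero ⟨0, h0⟩)
    funext s
    show F (Hl (s, ⟨0, h0⟩)) = F w₀
    rw [hlifts (s, ⟨0, h0⟩), hw₀]
    show F ((s : ℝ) • (0 : E)) = F 0
    rw [smul_zero]
  have h1 : Hl (1, ⟨0, h0⟩) = w₀ := congr_fun hconst 1
  rw [hend0] at h1
  exact h1.symm

/-- **A covering map of a path connected space by a vector space with a saturated star-shaped
ball is injective** (all fibres are in bijection with the trivial fibre over the centre, by
monodromy). [folklore] -/
theorem injective_of_star [PathConnectedSpace N] (hF : IsCoveringMap F) {K : Set E}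
    (h0 : (0 : E) ∈ K) (hstar : StarConvex ℝ (0 : E) K) (hsat : ∀ w, F w ∈ F '' K → w ∈ K)
    (e : K ≃ₜ closedBall (0 : E) 1) : Injective F := by
  have hfib := preimage_apply_zero_eq_of_star hF h0 hstar hsat e
  intro a b hab
  -- monodromy along a path from `F 0` to `F a` is a bijection of fibres
  set γ : Path (F 0) (F a) := PathConnectedSpace.somePath (F 0) (F a) with hγ
  have hbij := hF.monodromy_bijective (⟦γ⟧ : Path.Homotopic.Quotient (F 0) (F a))
  have hsub : Subsingleton (F ⁻¹' {F 0}) := by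
    refine ⟨fun u v ↦ Subtype.ext ?_⟩
    have hu : (u : E) ∈ ({0} : Set E) := hfib ▸ u.2
    have hv : (v : E) ∈ ({0} : Set E) := hfib ▸ v.2
    rw [mem_singleton_iff.1 hu, mem_singleton_iff.1 hv]
  have hsub' : Subsingleton (F ⁻¹' {F a}) := (Equiv.ofBijective _ hbij).symm.subsingleton
  have h := hsub'.elim ⟨a, rfl⟩ ⟨b, hab.symm⟩
  exact congrArg Subtype.val h

end SimpleAH

end Literature.Geometry.Riemannian

end
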